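import Summits.KontsevichZagierPeriods.KontsevichZagierPeriods.Theorems.BetaCancellation.Negative.LoadBearing
import Literature.NumberTheory.Transcendental.KZMellinFibres
import Literature.NumberTheory.Transcendental.KZLogCalculusProofs

/-!
# `BetaCancellation` (stmt-KontsevichZagierPeriods-13633) — line `dirichlet-companion-to-pi`,
stub `stub_dirichletPolar`

The FIRST of Dirichlet's two simplex substitutions (Andrews–Askey–Roy, Thm. 1.8.1) as ONE
change-of-variables move (rule (2) of the Kontsevich–Zagier calculus, `KZ.changeOfVariablesRel`):
the "polar" chart `Φ(u,v) = (u·v, u·(1−v))` maps the open box `(0,1)²` bijectively onto the open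
simplex `{x > 0, y > 0, x + y < 1}` (inverse `u = x + y`, `v = x/(x+y)`), its Jacobian matrix is
`(v, u; 1−v, −u)` with determinant `−u`, so `|det DΦ| = u` on the box, and
`(uv)^{ℓ-1} (u(1-v))^{m-1} (1-u)^{-m} · u = u^{ℓ+m-1}(1-u)^{-m} · v^{ℓ-1}(1-v)^{m-1}`
(`polar_kernel_identity`). Hence for every representation
`P = [box, u^{ℓ+m-1}(1-u)^{-m} v^{ℓ-1}(1-v)^{m-1}]` the simplex representation
`S = [simplex, x^{ℓ-1} y^{m-1} (1-x-y)^{-m}]` EXISTS — its absolute convergence is transported from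
`P.integrableOn` through the chart by Mathlib's Jacobian criterion
`integrableOn_image_iff_integrableOn_abs_det_fderiv_smul`; its integrand is the Euler–Mellin
integrand of the family `(X₀, X₁, 1 − X₀ − X₁)` with exponents `(ℓ−1, m−1, −m)`, hence
`ℚ`-semialgebraic by `KZ.isSemialgebraicFunOn_mellinIntegrand` — and `[P] − [S] ∈ changeOfVariablesRel`,
so `KZ.Equivalent P S` (`stub_dirichletPolar`). The pattern is that of
`Theorems/MultiplicationThree/Negative/Pinned.lean`, `…/BoxToBox.lean` (chart of a triangle by the
box); no definitions are introduced (the chart, its derivative and the two integrands are written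
out), so that the file is a pure proof file.

References: M. Kontsevich, D. Zagier, *Periods* (2001), §1.2 rule (2); G. Andrews, R. Askey, R. Roy,
*Special Functions* (1999), Thm. 1.8.1 (Dirichlet's integral).
-/

noncomputable section

-- `Summit.KontsevichZagierPeriods.KontsevichZagierPeriods.…` is the tree's mandated layout (single-conjunct summit).
set_option linter.dupNamespace false

namespace Summit.KontsevichZagierPeriods.KontsevichZagierPeriods.BetaCancellationLine

open MeasureTheory Set Real
open Literature.NumberTheory.Transcendental
open Literature.NumberTheory.Transcendental.KZ
open Literature.ModelTheory.ExponentialFields (IsSemialgebraic)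
open MvPolynomial (aeval X C)

/-! ## The two domains -/

/-- The open box `(0,1)²` as spelled in the stub is the box `{x | ∀ j, x j ∈ (0,1)}` of
`KZ.isSemialgebraic_box`. [folklore] -/
theorem polarBox_eq : {z : Fin 2 → ℝ | z 0 ∈ Set.Ioo (0:ℝ) 1 ∧ z 1 ∈ Set.Ioo (0:ℝ) 1} =
    {x : Fin 2 → ℝ | ∀ j, x j ∈ Set.Ioo (0:ℝ) 1} := by
  ext x
  simp [Fin.forall_fin_two]

/-- The open box `(0,1)²` is `ℚ`-semialgebraic. [folklore] -/
theorem isSemialgebraic_polarBox :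
    IsSemialgebraic ℚ {z : Fin 2 → ℝ | z 0 ∈ Set.Ioo (0:ℝ) 1 ∧ z 1 ∈ Set.Ioo (0:ℝ) 1} := by
  rw [polarBox_eq]; exact KZ.isSemialgebraic_box 2

/-- The open box `(0,1)²` is Lebesgue measurable. [folklore] -/
theorem measurableSet_polarBox :
    MeasurableSet {z : Fin 2 → ℝ | z 0 ∈ Set.Ioo (0:ℝ) 1 ∧ z 1 ∈ Set.Ioo (0:ℝ) 1} :=
  IsSemialgebraic.measurableSet_holds isSemialgebraic_polarBox

/-- Evaluating the describing polynomials `(X₀, X₁, 1 − X₀ − X₁)` of the open simplex. [folklore] -/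
theorem aeval_polarSimplexPolys (x : Fin 2 → ℝ) (l : Fin 3) :
    aeval x ((![X 0, X 1, 1 - X 0 - X 1] : Fin 3 → MvPolynomial (Fin 2) ℚ) l) =
      (![x 0, x 1, 1 - x 0 - x 1] : Fin 3 → ℝ) l := by
  fin_cases l <;> simp

/-- The open simplex is cut out by `X₀ > 0`, `X₁ > 0`, `1 − X₀ − X₁ > 0`. [folklore] -/
theorem polarSimplex_eq : {z : Fin 2 → ℝ | 0 < z 0 ∧ 0 < z 1 ∧ z 0 + z 1 < 1} =
    {x | ∀ l, 0 < aeval x ((![X 0, X 1, 1 - X 0 - X 1] : Fin 3 → MvPolynomial (Fin 2) ℚ) l)} := by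
  ext x
  simp only [mem_setOf_eq, aeval_polarSimplexPolys, Fin.forall_fin_succ, Matrix.cons_val_zero,
    Matrix.cons_val_succ, IsEmpty.forall_iff, and_true, sub_pos]
  constructor
  · rintro ⟨h0, h1, h2⟩; exact ⟨h0, h1, by linarith⟩
  · rintro ⟨h0, h1, h2⟩; exact ⟨h0, h1, by linarith⟩

/-- The open simplex `{x > 0, y > 0, x + y < 1}` is `ℚ`-semialgebraic. [folklore] -/
theorem isSemialgebraic_polarSimplex :
    IsSemialgebraic ℚ {z : Fin 2 → ℝ | 0 < z 0 ∧ 0 < z 1 ∧ z 0 + z 1 < 1} := by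
  rw [polarSimplex_eq]; exact isSemialgebraic_setOf_forall_aeval_pos _

/-! ## The simplex integrand -/

/-- The simplex integrand `x^{ℓ-1} y^{m-1} (1-x-y)^{-m}` is `ℚ`-semialgebraic on the open simplex:
it is the Euler–Mellin integrand of the family `(X₀, X₁, 1 − X₀ − X₁)` (positive there) with the
rational exponents `(ℓ−1, m−1, −m)` and constant `1` (`KZ.isSemialgebraicFunOn_mellinIntegrand`). [folklore] -/
theorem isSemialgebraicFunOn_polarSimplexFun (ℓ m : ℚ) :
    IsSemialgebraicFunOn ℚ {z : Fin 2 → ℝ | 0 < z 0 ∧ 0 < z 1 ∧ z 0 + z 1 < 1}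
      (fun z => (z 0) ^ ((ℓ:ℝ) - 1) * (z 1) ^ ((m:ℝ) - 1) * (1 - z 0 - z 1) ^ (-(m:ℝ))) := by
  refine (isSemialgebraicFunOn_mellinIntegrand isSemialgebraic_polarSimplex
    (![X 0, X 1, 1 - X 0 - X 1] : Fin 3 → MvPolynomial (Fin 2) ℚ) ![ℓ - 1, m - 1, -m] 1 ?_).congr
    fun x _ => ?_
  · intro x hx
    rw [polarSimplex_eq] at hx
    exact hx
  · simp only [mellinIntegrand, Fin.prod_univ_three, aeval_polarSimplexPolys, Matrix.cons_val_zero,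
      Matrix.cons_val_one, Matrix.cons_val_two, Matrix.head_cons, Matrix.tail_cons, Rat.cast_one,
      one_mul, Rat.cast_sub, Rat.cast_neg]

/-- **The pull-back identity** of the polar chart (Jacobian `u` included), for `u > 0`, `0 < v < 1`:
`(uv)^{ℓ-1} (u(1-v))^{m-1} (1 − uv − u(1−v))^{-m} · u = u^{ℓ+m-1}(1-u)^{-m} · v^{ℓ-1}(1-v)^{m-1}`
(`1 − uv − u(1−v) = 1 − u`; `rpow` algebra for positive bases). [folklore] -/
theorem polar_kernel_identity (ℓ m : ℚ) {u v : ℝ} (hu : 0 < u) (hv : 0 < v) (hv1 : v < 1) :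
    (u * v) ^ ((ℓ:ℝ) - 1) * (u * (1 - v)) ^ ((m:ℝ) - 1) * (1 - u * v - u * (1 - v)) ^ (-(m:ℝ)) * u =
      u ^ ((ℓ:ℝ) + m - 1) * (1 - u) ^ (-(m:ℝ)) * (v ^ ((ℓ:ℝ) - 1) * (1 - v) ^ ((m:ℝ) - 1)) := by
  have hv1' : 0 < 1 - v := sub_pos.2 hv1
  have h1 : 1 - u * v - u * (1 - v) = 1 - u := by ring
  rw [h1, Real.mul_rpow hu.le hv.le, Real.mul_rpow hu.le hv1'.le]
  have h3 : u ^ ((ℓ:ℝ) + m - 1) = u ^ ((ℓ:ℝ) - 1) * u ^ ((m:ℝ) - 1) * u := by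
    rw [← Real.rpow_add hu, ← Real.rpow_add_one hu.ne']
    congr 1
    ring
  rw [h3]
  ring

/-! ## The polar chart `Φ(u,v) = (uv, u(1-v))` of the simplex by the box -/

/-- The polar chart is differentiable, with a derivative of determinant `−u` (the Jacobian matrix
`(v, u; 1−v, −u)` as `Matrix.toLin'`). [folklore] -/
theorem hasFDerivAt_polarChart (x : Fin 2 → ℝ) :
    ∃ L : (Fin 2 → ℝ) →L[ℝ] (Fin 2 → ℝ),
      HasFDerivAt (fun y : Fin 2 → ℝ => (![y 0 * y 1, y 0 * (1 - y 1)] : Fin 2 → ℝ)) L x ∧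
      L.det = -(x 0) := by
  set L : (Fin 2 → ℝ) →L[ℝ] (Fin 2 → ℝ) := LinearMap.toContinuousLinearMap
    (Matrix.toLin' (!![x 1, x 0; 1 - x 1, -(x 0)] : Matrix (Fin 2) (Fin 2) ℝ)) with hL
  have hL0 : ∀ v, L v 0 = x 1 * v 0 + x 0 * v 1 := by
    intro v
    change Matrix.toLin' (!![x 1, x 0; 1 - x 1, -(x 0)] : Matrix (Fin 2) (Fin 2) ℝ) v 0 = _
    rw [Matrix.toLin'_apply]
    simp [Matrix.mulVec, dotProduct, Fin.sum_univ_two]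
  have hL1 : ∀ v, L v 1 = (1 - x 1) * v 0 + -(x 0) * v 1 := by
    intro v
    change Matrix.toLin' (!![x 1, x 0; 1 - x 1, -(x 0)] : Matrix (Fin 2) (Fin 2) ℝ) v 1 = _
    rw [Matrix.toLin'_apply]
    simp [Matrix.mulVec, dotProduct, Fin.sum_univ_two]
  refine ⟨L, ?_, ?_⟩
  · have h0 : HasFDerivAt (fun y : Fin 2 → ℝ => y 0)
        (ContinuousLinearMap.proj (R := ℝ) (φ := fun _ : Fin 2 => ℝ) 0) x :=
      hasFDerivAt_apply 0 x
    have h1 : HasFDerivAt (fun y : Fin 2 → ℝ => y 1)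
        (ContinuousLinearMap.proj (R := ℝ) (φ := fun _ : Fin 2 => ℝ) 1) x :=
      hasFDerivAt_apply 1 x
    rw [hasFDerivAt_pi']
    refine Fin.forall_fin_two.mpr ⟨?_, ?_⟩
    · have hf : (fun y : Fin 2 → ℝ => (![y 0 * y 1, y 0 * (1 - y 1)] : Fin 2 → ℝ) 0) =
          fun y => y 0 * y 1 := funext fun y => rfl
      rw [hf]
      refine (h0.mul h1).congr_fderiv (ContinuousLinearMap.ext fun v => ?_)
      rw [ContinuousLinearMap.comp_apply, ContinuousLinearMap.proj_apply, hL0]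
      simp
      ring
    · have hf : (fun y : Fin 2 → ℝ => (![y 0 * y 1, y 0 * (1 - y 1)] : Fin 2 → ℝ) 1) =
          fun y => y 0 * (1 - y 1) := funext fun y => rfl
      rw [hf]
      refine (h0.mul (h1.const_sub 1)).congr_fderiv (ContinuousLinearMap.ext fun v => ?_)
      rw [ContinuousLinearMap.comp_apply, ContinuousLinearMap.proj_apply, hL1]
      simp
      ring
  · change LinearMap.det (Matrix.toLin' (!![x 1, x 0; 1 - x 1, -(x 0)] : Matrix (Fin 2) (Fin 2) ℝ)) = _
    rw [LinearMap.det_toLin', Matrix.det_fin_two]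
    simp
    ring

/-- The polar chart is injective on the box (`u = x + y`, then cancel `u ≠ 0`). [folklore] -/
theorem injOn_polarChart :
    InjOn (fun y : Fin 2 → ℝ => (![y 0 * y 1, y 0 * (1 - y 1)] : Fin 2 → ℝ))
      {z : Fin 2 → ℝ | z 0 ∈ Set.Ioo (0:ℝ) 1 ∧ z 1 ∈ Set.Ioo (0:ℝ) 1} := by
  intro x _ y hy hxy
  have e0 := congrFun hxy 0
  have e1 := congrFun hxy 1
  simp only [Matrix.cons_val_zero, Matrix.cons_val_one] at e0 e1
  have h0 : x 0 = y 0 := by linarith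
  have h1 : x 1 = y 1 := by
    rw [h0] at e0
    exact mul_left_cancel₀ (hy.1.1.ne') e0
  funext i
  fin_cases i
  · exact h0
  · exact h1

/-- The polar chart maps the box ONTO the open simplex (inverse `u = x + y`, `v = x / (x + y)`). [folklore] -/
theorem image_polarChart :
    (fun y : Fin 2 → ℝ => (![y 0 * y 1, y 0 * (1 - y 1)] : Fin 2 → ℝ)) ''
        {z : Fin 2 → ℝ | z 0 ∈ Set.Ioo (0:ℝ) 1 ∧ z 1 ∈ Set.Ioo (0:ℝ) 1} =
      {z : Fin 2 → ℝ | 0 < z 0 ∧ 0 < z 1 ∧ z 0 + z 1 < 1} := by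
  ext y
  constructor
  · rintro ⟨x, ⟨h0, h1⟩, rfl⟩
    refine ⟨?_, ?_, ?_⟩
    · show 0 < x 0 * x 1
      exact mul_pos h0.1 h1.1
    · show 0 < x 0 * (1 - x 1)
      exact mul_pos h0.1 (sub_pos.2 h1.2)
    · show x 0 * x 1 + x 0 * (1 - x 1) < 1
      nlinarith [h0.2]
  · rintro ⟨hy0, hy1, hy2⟩
    have hs : 0 < y 0 + y 1 := by linarith
    refine ⟨![y 0 + y 1, y 0 / (y 0 + y 1)], ⟨?_, ?_⟩, ?_⟩
    · show y 0 + y 1 ∈ Ioo (0:ℝ) 1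
      exact ⟨hs, hy2⟩
    · show y 0 / (y 0 + y 1) ∈ Ioo (0:ℝ) 1
      exact ⟨div_pos hy0 hs, by rw [div_lt_one hs]; linarith⟩
    · funext i
      fin_cases i
      · show (y 0 + y 1) * (y 0 / (y 0 + y 1)) = y 0
        field_simp
      · show (y 0 + y 1) * (1 - y 0 / (y 0 + y 1)) = y 1
        field_simp
        ring

/-- The polar chart is a `ℚ`-semialgebraic map on the box (a polynomial map, substitution
polynomials `(X₀X₁, X₀(1 − X₁))`). [folklore] -/
theorem isSemialgebraicMapOn_polarChart :
    IsSemialgebraicMapOn ℚ {z : Fin 2 → ℝ | z 0 ∈ Set.Ioo (0:ℝ) 1 ∧ z 1 ∈ Set.Ioo (0:ℝ) 1}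
      (fun y : Fin 2 → ℝ => (![y 0 * y 1, y 0 * (1 - y 1)] : Fin 2 → ℝ)) := by
  refine (isSemialgebraicMapOn_aeval isSemialgebraic_polarBox
    (![X 0 * X 1, X 0 * (1 - X 1)] : Fin 2 → MvPolynomial (Fin 2) ℚ)).congr fun x _ => ?_
  funext i
  fin_cases i <;> simp

/-! ## The stub -/

/-- **Registered stub `stub_dirichletPolar`** (line `dirichlet-companion-to-pi` of crux
stmt-KontsevichZagierPeriods-13633): the polar chart `(u,v) ↦ (uv, u(1-v))` of the box onto the open
simplex is one rule-(2) move, `[box, u^{ℓ+m-1}(1-u)^{-m} v^{ℓ-1}(1-v)^{m-1}] ∼ [simplex, x^{ℓ-1} y^{m-1} (1-x-y)^{-m}]`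
— for every such `P` a simplex representation `S` with the displayed domain and integrand exists and
`KZ.Equivalent P S`. (The hypotheses `0 < ℓ`, `0 < m < 1` are not used: convergence of `S` is
transported from that of `P` through the chart.) [cite: KontsevichZagier2001, §1.2 rule (2)] -/
theorem stub_dirichletPolar : ∀ (ℓ m : ℚ), 0 < ℓ → 0 < m → m < 1 →
    ∀ (P : Literature.NumberTheory.Transcendental.KZ.IntegralRep 2),
    P.domain = {z | z 0 ∈ Set.Ioo (0:ℝ) 1 ∧ z 1 ∈ Set.Ioo (0:ℝ) 1} →
    Set.EqOn P.integrand (fun z => (z 0) ^ ((ℓ:ℝ) + m - 1) * (1 - z 0) ^ (-(m:ℝ)) *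
      ((z 1) ^ ((ℓ:ℝ) - 1) * (1 - z 1) ^ ((m:ℝ) - 1))) P.domain →
    ∃ S : Literature.NumberTheory.Transcendental.KZ.IntegralRep 2,
      S.domain = {z | 0 < z 0 ∧ 0 < z 1 ∧ z 0 + z 1 < 1} ∧
      Set.EqOn S.integrand (fun z => (z 0) ^ ((ℓ:ℝ) - 1) * (z 1) ^ ((m:ℝ) - 1) *
        (1 - z 0 - z 1) ^ (-(m:ℝ))) S.domain ∧
      Literature.NumberTheory.Transcendental.KZ.Equivalent P S := by
  intro ℓ m _ _ _ P hPd hPi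
  choose Φ' hD hdet using hasFDerivAt_polarChart
  -- the pull-back identity on the box, Jacobian `|det DΦ| = u` included
  have hpull : ∀ x ∈ {z : Fin 2 → ℝ | z 0 ∈ Set.Ioo (0:ℝ) 1 ∧ z 1 ∈ Set.Ioo (0:ℝ) 1},
      (fun z : Fin 2 → ℝ => (z 0) ^ ((ℓ:ℝ) - 1) * (z 1) ^ ((m:ℝ) - 1) * (1 - z 0 - z 1) ^ (-(m:ℝ)))
          ((fun y : Fin 2 → ℝ => (![y 0 * y 1, y 0 * (1 - y 1)] : Fin 2 → ℝ)) x) * |(Φ' x).det| =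
        (x 0) ^ ((ℓ:ℝ) + m - 1) * (1 - x 0) ^ (-(m:ℝ)) *
          ((x 1) ^ ((ℓ:ℝ) - 1) * (1 - x 1) ^ ((m:ℝ) - 1)) := by
    rintro x ⟨hx0, hx1⟩
    rw [hdet x, abs_neg, abs_of_pos hx0.1]
    simp only [Matrix.cons_val_zero, Matrix.cons_val_one]
    exact polar_kernel_identity ℓ m hx0.1 hx1.1 hx1.2
  -- absolute convergence of `P`'s displayed integrand on the box, and of `S`'s on the simplex
  have hPint : IntegrableOn (fun z : Fin 2 → ℝ => (z 0) ^ ((ℓ:ℝ) + m - 1) * (1 - z 0) ^ (-(m:ℝ)) *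
      ((z 1) ^ ((ℓ:ℝ) - 1) * (1 - z 1) ^ ((m:ℝ) - 1)))
      {z : Fin 2 → ℝ | z 0 ∈ Set.Ioo (0:ℝ) 1 ∧ z 1 ∈ Set.Ioo (0:ℝ) 1} := by
    have hint := P.integrableOn.congr_fun hPi (IntegralRep.measurableSet_domain_holds P)
    rw [hPd] at hint
    exact hint
  have hSint : IntegrableOn
      (fun z : Fin 2 → ℝ => (z 0) ^ ((ℓ:ℝ) - 1) * (z 1) ^ ((m:ℝ) - 1) * (1 - z 0 - z 1) ^ (-(m:ℝ)))
      {z : Fin 2 → ℝ | 0 < z 0 ∧ 0 < z 1 ∧ z 0 + z 1 < 1} := by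
    rw [← image_polarChart, integrableOn_image_iff_integrableOn_abs_det_fderiv_smul volume
      measurableSet_polarBox (fun x _ => (hD x).hasFDerivWithinAt) injOn_polarChart]
    refine hPint.congr_fun (fun x hx => ?_) measurableSet_polarBox
    rw [smul_eq_mul, mul_comm]
    exact (hpull x hx).symm
  -- the simplex representation and the move
  let S : IntegralRep 2 := ⟨{z : Fin 2 → ℝ | 0 < z 0 ∧ 0 < z 1 ∧ z 0 + z 1 < 1},
    fun z : Fin 2 → ℝ => (z 0) ^ ((ℓ:ℝ) - 1) * (z 1) ^ ((m:ℝ) - 1) * (1 - z 0 - z 1) ^ (-(m:ℝ)),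
    isSemialgebraic_polarSimplex, isSemialgebraicFunOn_polarSimplexFun ℓ m, hSint⟩
  refine ⟨S, rfl, fun _ _ => rfl, changeOfVariablesRel_subset_relations
    ⟨2, P, S, fun y : Fin 2 → ℝ => (![y 0 * y 1, y 0 * (1 - y 1)] : Fin 2 → ℝ), Φ', ?_,
      fun x _ => (hD x).hasFDerivWithinAt, ?_, ?_, fun x hx => ?_, rfl⟩⟩
  · rw [hPd]; exact isSemialgebraicMapOn_polarChart
  · rw [hPd]; exact injOn_polarChart
  · rw [hPd, image_polarChart]
  · rw [hPi hx]
    rw [hPd] at hx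
    exact (hpull x hx).symm

end Summit.KontsevichZagierPeriods.KontsevichZagierPeriods.BetaCancellationLine
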